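/-
Copyright: the b2b-balaban cell (near-miss cell 7), T⁴-continuum fan-out; row NE7b ROUND-2 swarm, seat
t4-ne7b-formalise-leaf-10 (gen 3; sub-row S6g′(f) of `t4/b2b-balaban-t4-ne7b-p1/LEAVES-NE7b.md`, owner's ruling
R-OWNER-22-12 (2)).  Released under the licence of the surrounding project.
-/
import Summits.QuantumFields.BalabanUV.T4Continuum.Support.HistorySiblingEntropyDischarge
import Summits.QuantumFields.BalabanUV.T4Continuum.Support.HistoryZoneMassDatingGen

/-!
# Sibling entropy bound, glue: the chronology display `Mono` is FREE on tagged genealogies of pedigrees (row S6g′(f))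

Summits-side support leaf of the T⁴-continuum cell (rung (B)+1 on a FINITE torus only; NOT infinite volume, NOT the
mass gap, NOT the Clay statement; NOT a proof of the spine estimate NE7b).  Row NE7b, route «COUNT», row S6g′; sequel
of `HistorySiblingEntropyDischarge`.  [folklore] structural recursion over leaf-09's `Pedigree.genT` and leaf-02 gen
3's `RenewStrict`; nothing is quoted from print, nothing printed is asserted, no `[cite:]` tag, no `Prop` fact minted.

WHAT.  `birthStep_chainMerge`, **`birthStep_genT`** (every birth node of `P.genT c` is `born ((step c, 0, d), tag)
(step c)` — `BirthStep` by construction), `birthStep_relabel`∕`mono_relabel` (step-preserving relabellings, e.g. the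
shape tree), and **`mono_genT : (∀ c, P.HeadOldest c) → Mono (PEv.step ∘ Prod.fst) (P.genT c)`** =
`mono_of_chrono ∘ ⟨birthStep_genT, HistoryGenTimed.chronoC_genT, HistoryZoneMassDatingGen.renewStrict_genT⟩`: of the
three displays of `HistorySiblingEntropyDischarge.ENT_le`, the first costs only `HeadOldest` (already displayed by the
ENDs of record); `ShapeSorted` (the convention) and `InjParts` remain displayed.

HONEST SCOPE.  Glue only.  NE7b NOT proved.  HONEST DEPENDENCY (cell): continuum YM on T⁴ ⇐ BetaPertH ∧ nine spine
estimates (0/9 proved); BetaPertH ⇐ (D1) ∧ (D4) ∧ CAP+tail; G-an2-4 gates asym, D1 and NE2/3/4.  This file changes none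
of it.
-/

open Finset
open Literature.MathematicalPhysics.QuantumFieldTheory.Balaban1983to89
open T4PersistenceDictionary T4BranchingRecordsGas T4CanonicalMenus
open Summit.QuantumFields.BalabanUV.T4Continuum.HistoryGen
open Summit.QuantumFields.BalabanUV.T4Continuum.HistoryZoneMassDating
open Summit.QuantumFields.BalabanUV.T4Continuum.HistoryZoneMassDatingGen

namespace Summit.QuantumFields.BalabanUV.T4Continuum.HistorySiblingEntropyBridge

/-! ## §1 `BirthStep` on chains, on tagged genealogies, along relabellings -/

section Chain

variable {ε : Type*} {st : ε → ℕ}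

/-- births of a merger [folklore] -/
@[simp] theorem birthStep_merge (X Y : Gen ε) (e : ε) :
    BirthStep st (Gen.merge X Y e) ↔ BirthStep st X ∧ BirthStep st Y := Iff.rfl

/-- births of a renewal [folklore] -/
@[simp] theorem birthStep_renew (G : Gen ε) (e : ε) (h : ℕ) : BirthStep st (Gen.renew G e h) ↔ BirthStep st G :=
  Iff.rfl

/-- a binary-merger chain of `BirthStep` structures is `BirthStep` [folklore] -/
theorem birthStep_chainMerge : ∀ (G : Gen ε) (Hs : List (Gen ε)) (t : ℕ → ε),
    BirthStep st G → (∀ H ∈ Hs, BirthStep st H) → BirthStep st (chainMerge G Hs t)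
  | _, [], _, hG, _ => hG
  | G, H :: Hs, t, hG, hHs => by
      rw [chainMerge_cons]
      exact birthStep_chainMerge _ Hs _ ((birthStep_merge _ _ _).2 ⟨hG, hHs H List.mem_cons_self⟩)
        fun H' h => hHs H' (List.mem_cons_of_mem _ h)

end Chain

section GenT

variable {α π : Type*}

/-- **EVERY TAGGED GENEALOGY READS ITS BIRTHS BY THEIR STEP**: `BirthStep (PEv.step ∘ Prod.fst) (P.genT c)`.
[folklore] -/
theorem birthStep_genT (P : Pedigree α π) (c : α) : BirthStep (PEv.step ∘ Prod.fst) (P.genT c) := by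
  rw [Pedigree.genT_eq]
  unfold Pedigree.partsGen
  have hpart : ∀ (i : ℕ) (q : Part α π), q ∈ P.parts c →
      BirthStep (PEv.step ∘ Prod.fst) (P.partGen c P.genT i q) := by
    intro i q hq
    rcases q with ⟨c', r⟩ | ⟨d, x⟩
    · have hlt := P.step_lt c c' r hq
      have ih := birthStep_genT P c'
      rcases r with _ | _
      · exact ih
      · simp only [Pedigree.partGen, birthStep_renew]; exact ih
    · simp [Pedigree.partGen, BirthStep]
  cases hps : P.parts c with
  | nil => simp [Pedigree.join, BirthStep]
  | cons p ps =>
      rw [Pedigree.partsGenAux_cons]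
      have hsub : ∀ q ∈ p :: ps, q ∈ P.parts c := fun q hq => by rw [hps]; exact hq
      show BirthStep (PEv.step ∘ Prod.fst) (chainMerge _ _ _)
      refine birthStep_chainMerge _ _ _ (hpart 0 p (hsub p List.mem_cons_self)) fun H hH => ?_
      obtain ⟨k, q, hq, rfl⟩ := P.mem_partsGenAux hH
      exact hpart _ q (hsub q (List.mem_cons_of_mem _ hq))
termination_by P.step c
decreasing_by exact hlt

/-- **THE CHRONOLOGY DISPLAY IS FREE ON PEDIGREES**: `HeadOldest` alone gives `Mono` of every tagged genealogy.
[folklore] -/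
theorem mono_genT [DecidableEq α] [DecidableEq π] (P : Pedigree α π) (hH : ∀ c, P.HeadOldest c) (c : α) :
    Mono (PEv.step ∘ Prod.fst) (P.genT c) :=
  mono_of_chrono _ (birthStep_genT P c) (Pedigree.chronoC_genT hH c) (renewStrict_genT P c)

end GenT

section Relabel

variable {ε δ : Type*} (f : ε → δ) {st : ε → ℕ} {st' : δ → ℕ} (hst : ∀ e, st' (f e) = st e)
include hst

/-- `BirthStep` survives a step-preserving relabelling [folklore] -/
theorem birthStep_relabel : ∀ {G : Gen ε}, BirthStep st G → BirthStep st' (relabel f G)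
  | Gen.born b j, h => by rw [relabel_born]; simp only [BirthStep] at h ⊢; rw [hst]; exact h
  | Gen.renew Y e h, hR => by rw [relabel_renew]; exact birthStep_relabel hR
  | Gen.merge A B e, hR => by
      rw [relabel_merge]
      exact ⟨birthStep_relabel hR.1, birthStep_relabel hR.2⟩

/-- the top step is invariant under a step-preserving relabelling [folklore] -/
theorem top_relabel : ∀ G : Gen ε, top st' (relabel f G) = top st G
  | Gen.born _ _ => rfl
  | Gen.renew _ e _ => by rw [relabel_renew]; simp only [top]; exact hst e
  | Gen.merge _ _ e => by rw [relabel_merge]; simp only [top]; exact hst e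

/-- `Mono` survives a step-preserving relabelling (e.g. the shape tree `relabel (shape ∘ sh) G`) [folklore] -/
theorem mono_relabel : ∀ {G : Gen ε}, Mono st G → Mono st' (relabel f G)
  | Gen.born _ _, _ => trivial
  | Gen.renew Y e h, hm => by
      rw [relabel_renew]
      simp only [Mono] at hm ⊢
      rw [top_relabel f hst, hst]
      exact ⟨mono_relabel hm.1, hm.2⟩
  | Gen.merge A B e, hm => by
      rw [relabel_merge]
      simp only [Mono] at hm ⊢
      rw [top_relabel f hst, top_relabel f hst, hst]
      exact ⟨mono_relabel hm.1, mono_relabel hm.2.1, hm.2.2.1, hm.2.2.2⟩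

end Relabel

end Summit.QuantumFields.BalabanUV.T4Continuum.HistorySiblingEntropyBridge
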